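import Literature.AlgebraicGeometry.HodgeTheory.SupportedClassesGysinSpan
import Literature.AlgebraicGeometry.HodgeTheory.HolomorphicBundleChernCharacterTopDegree
import Literature.AlgebraicTopology.SingularHomology.CompactGroupExteriorCohomology
import HarnessLib

/-!
# Algebraic classes are spanned by the Gysin images `g_* 1_V` of smooth projective `d`-folds

Family `hodge`, layer `Literature/AlgebraicGeometry/HodgeTheory`, on top of
`SupportedClassesGysinSpan` (Grothendieck's two descriptions of coniveau agree:
`supportedClasses X k r = Σ g_* Hᵃ(Y(ℂ); ℂ)` over `g : Y ⟶ X`, `Y` smooth projective with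
`dim Y + r ≤ dim X`, `a + 2 dim X = k + 2 dim Y` — unconditional, from Deligne Hodge III Cor. 8.2.8
and Hironaka, both theorems of the tree).

In the degree of algebraic classes (`k = 2p`, `r = p`, `dim X = n = d + p`) the degree bookkeeping
forces `dim Y = d` and `a = 0`, and `H⁰(Y(ℂ); ℂ) = ℂ · 1_Y` because `Y(ℂ)` is path connected
(`Y` is geometrically irreducible — `pathConnectedSpace_complexPoints_of_isSmoothProjective`;
`singularCohomology.eq_smul_one`). Hence the printed description of Fulton, §19.1 / Deligne,
Remark (vi) / Voisin I, §11.1.2 on the tree's carriers, WITHOUT a cycle class map: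

* `algebraicClasses_eq_span_complexGysin_one` — **for `X` smooth projective of dimension
  `n = d + p` and EVERY orientation family `μ`,
  `algebraicClasses X p = span_ℂ {g_* 1_V | g : V ⟶ X, V smooth projective of dimension d}`**
  (`g_* = complexGysin μ`, `1_V = singularCohomology.one`);
* `complexGysin_one_mem_algebraicClasses_codim` — each generator is an algebraic class.

(The same statement for `μ = complexOrientationFamily` is the helper
`Summit.HodgeConjecture.HodgeConjecture.Theorems.kontsevichTransferKS_effectiveSpan` of the Hodge
summit; this file is its Literature-side home, importable by Literature consumers.)
Everything is proved; no definitions, no named facts.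

## References

* [Fulton1998] W. Fulton, Intersection Theory, 2nd ed. (1998), §19.1, Lemma 19.1.1 and the
  definition of `cl`.
* [Deligne2000] P. Deligne, The Hodge conjecture (Clay, 2000), §1 and Remark (vi).
* [GrothendieckTopology1969] A. Grothendieck, Hodge's general conjecture is false for trivial
  reasons, Topology 8 (1969), §1 and p. 300.
* [VoisinHodgeI2002] C. Voisin, Hodge Theory and Complex Algebraic Geometry I (2002), §11.1.2.
* [HatcherAT2002] A. Hatcher, Algebraic Topology (2002), §3.1 p. 199 (`H⁰` of a path-connected space).
-/

noncomputable section

open CategoryTheory AlgebraicGeometry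
open Literature.AlgebraicTopology.SingularHomology

namespace Literature.AlgebraicGeometry.HodgeTheory

section HodgeTheory

variable {n : ℕ} {X : Motives.SchemeOver ℂ}

/-- **Each generator is algebraic**: `g_* 1_V ∈ algebraicClasses X p` for `g : V ⟶ X`, `V` smooth
projective of dimension `d`, `d + p = n` (it dies off the closed image `g(V)`, of codimension `≥ p`).
[cite: GrothendieckTopology1969, §1] [cite: Fulton1998, §19.1] -/
theorem complexGysin_one_mem_algebraicClasses_codim (μ : OrientationFamily) {p d : ℕ} (hdp : d + p = n)
    {V : Motives.SchemeOver ℂ} (hV : Motives.IsSmoothProjective d V)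
    (hX : Motives.IsSmoothProjective n X) (g : V ⟶ X) (hab : 0 + 2 * n = 2 * p + 2 * d) :
    complexGysin μ hV hX g hab (singularCohomology.one ℂ (Motives.ComplexPoints V)) ∈
      algebraicClasses X p :=
  complexGysin_mem_supportedClasses (gysinMap_restrictCompl_eq_zero_of_field ℂ) μ
    μ.hasPoincareDuality hV hX g hab (r := 0) (s := p) (by omega)
    (by rw [supportedClasses_zero]; exact Submodule.mem_top)

/-- **Algebraic classes are the span of the Gysin images `g_* 1_V` of the smooth projective
`d`-folds over `X`**, for `X` smooth projective of dimension `n = d + p` and every orientation family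
`μ`: `algebraicClasses X p = span_ℂ {complexGysin μ hV hX g _ 1_V | V smooth projective of
dimension d, g : V ⟶ X}` — the printed "`ℂ`-span of the cycle classes `cl(Z) = g_* [Z̃]`" of the
codimension-`p` subvarieties (resolved). `⊇`: `complexGysin_one_mem_algebraicClasses_codim`; `⊆`:
Grothendieck's Gysin description of `Nᵖ H²ᵖ` (`supportedClasses_eq_iSup_range_complexGysin`), the
degree bookkeeping `dim Y = d`, `a = 0`, and `H⁰(Y(ℂ); ℂ) = ℂ · 1_Y`.
[cite: Fulton1998, §19.1 Lemma 19.1.1] [cite: Deligne2000, §2 Remark (vi)]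
[cite: GrothendieckTopology1969, p. 300] -/
theorem algebraicClasses_eq_span_complexGysin_one (μ : OrientationFamily) (p d : ℕ)
    (hdp : d + p = n) (hX : Motives.IsSmoothProjective n X) :
    algebraicClasses X p =
      Submodule.span ℂ
        {c : complexBetti X (2 * p) | ∃ (V : Motives.SchemeOver ℂ)
          (hV : Motives.IsSmoothProjective d V) (g : V ⟶ X),
          c = complexGysin μ hV hX g (a := 0) (b := 2 * p) (by omega)
            (singularCohomology.one ℂ (Motives.ComplexPoints V))} := by
  apply le_antisymm
  · -- `⊆`: Grothendieck's Gysin description of coniveau `p` in degree `2p`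
    change supportedClasses X (2 * p) p ≤ _
    rw [supportedClasses_eq_iSup_range_complexGysin μ hX (2 * p) p]
    refine iSup_le fun m ↦ iSup_le fun hm ↦ iSup_le fun Y ↦ iSup_le fun hY ↦ iSup_le fun g ↦
      iSup_le fun a ↦ iSup_le fun hab ↦ ?_
    obtain rfl : m = d := by omega
    obtain rfl : a = 0 := by omega
    -- `H⁰(Y(ℂ); ℂ) = ℂ · 1_Y` (`Y(ℂ)` is path connected), so `g_* H⁰ = ℂ · g_* 1_Y`
    rintro _ ⟨y, rfl⟩
    haveI := pathConnectedSpace_complexPoints_of_isSmoothProjective hY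
    rw [singularCohomology.eq_smul_one ℂ y, map_smul]
    exact Submodule.smul_mem _ _ (Submodule.subset_span ⟨Y, hY, g, rfl⟩)
  · -- `⊇`: each generator dies off the closed image `g(V)`, of codimension `≥ p`
    refine Submodule.span_le.2 ?_
    rintro c ⟨V, hV, g, rfl⟩
    exact complexGysin_one_mem_algebraicClasses_codim μ hdp hV hX g _

/-- **Finite-family form.** A class is algebraic iff it is a finite `ℂ`-linear combination of Gysin
images `gⱼ_* 1_{Vⱼ}` of smooth projective `d`-folds `gⱼ : Vⱼ ⟶ X` (`d + p = n`).
[cite: Fulton1998, §19.1 Lemma 19.1.1] [cite: Deligne2000, §2 Remark (vi)] -/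
theorem mem_algebraicClasses_iff_exists_sum_complexGysin_one (μ : OrientationFamily) {p d : ℕ}
    (hdp : d + p = n) (hX : Motives.IsSmoothProjective n X) (c : complexBetti X (2 * p)) :
    c ∈ algebraicClasses X p ↔
      ∃ (ι : Type) (_ : Fintype ι) (V : ι → Motives.SchemeOver ℂ)
        (hV : ∀ j, Motives.IsSmoothProjective d (V j)) (g : ∀ j, V j ⟶ X) (a : ι → ℂ),
        c = ∑ j, a j • complexGysin μ (hV j) hX (g j) (a := 0) (b := 2 * p) (by omega)
          (singularCohomology.one ℂ (Motives.ComplexPoints (V j))) := by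
  classical
  constructor
  · intro hc
    rw [algebraicClasses_eq_span_complexGysin_one μ p d hdp hX] at hc
    obtain ⟨f, t, ht, -, hf⟩ := Submodule.mem_span_iff_exists_finset_subset.1 hc
    -- choose, for each generator in `t`, its presentation `g_* 1_V`
    have key : ∀ x : t, ∃ (V : Motives.SchemeOver ℂ) (hV : Motives.IsSmoothProjective d V)
        (g : V ⟶ X), (x : complexBetti X (2 * p)) =
          complexGysin μ hV hX g (a := 0) (b := 2 * p) (by omega)
            (singularCohomology.one ℂ (Motives.ComplexPoints V)) := fun x => ht x.2
    choose V hV g hVg using key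
    refine ⟨t, inferInstance, V, hV, g, fun x => f x, ?_⟩
    rw [← hf, ← Finset.sum_coe_sort]
    exact Finset.sum_congr rfl fun x _ => by rw [← hVg x]
  · rintro ⟨ι, _, V, hV, g, a, rfl⟩
    exact Submodule.sum_mem _ fun j _ =>
      Submodule.smul_mem _ _ (complexGysin_one_mem_algebraicClasses_codim μ hdp (hV j) hX (g j) _)

end HodgeTheory

end Literature.AlgebraicGeometry.HodgeTheory

end
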